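import Summits.RiemannHypothesis.RiemannHypothesis.Theses.GroundBarta
import Literature.NumberTheory.LFunctions.WeilGroundState
import Literature.NumberTheory.LFunctions.WeilOddGroundState
import Literature.NumberTheory.LFunctions.WeilGroundEnergyProofs
import Literature.NumberTheory.LFunctions.UniformWeilPositivityRH
import Literature.NumberTheory.LFunctions.WeilSemilocalCompactness

/-!
# Crux attack on `GroundBarta.GroundBartaFloor` (stmt-RiemannHypothesis-18389) — the logical shape

Refuter evidence (crux-attack at birth, refuter-rattack-stmt-RiemannHypothesis-18389-0, 2026-08-17).
Kernel-checked bookkeeping, no analysis (parity-free twin of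
`Cruxes/OddBartaFloor/OddBartaFloorLogic.lean`):

* `groundBartaFloor_iff` — the crux is LITERALLY (`Iff.rfl`) the statement over the Literature
  vocabulary `IsWeilTest` / `weilQuadratic`, with the hypothesis clause `GoodWindow a` = "the window
  carries a one-signed bottom state" in the junk-free `∀ h ∀ δ ∀ᶠ n` encoding; and
  `isGroundStateJF_iff` — that encoding IS Literature's `IsWeilGroundState` (bounded-below sphere,
  `bddBelow_weilQuadratic_sphere_holds`), so `GoodWindow a ↔ ∃ u, IsWeilGroundState a u ∧ sign`.
* `groundBartaFloor_of_riemannHypothesis` — `S → C` (Weil's easy half, `e ≡ 0`).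
* `groundBartaFloor_of_not_positiveGroundWindows` — `¬X → C` VACUOUSLY, where
  `X = PositiveGroundWindows` (one-signed full bottom states beyond every height) is the planner's
  redirected, unfiled thesis; and `positiveGroundWindows_of` — `X` is exactly what the route's cruxes
  #3 `PolarPerronFrobenius` + #4 `EvenWinsBeyondArch` deliver.
* `groundBartaFloor_iff_thesis_imp_rh` — HENCE `C ↔ (X → RiemannHypothesis)` UNCONDITIONALLY
  (monotonicity of the window class + `e → 0` along the unbounded good set give Weil positivity at
  every window, which is RH by Weil's criterion `weil_criterion_holds`, both halves in the tree);
  `not_groundBartaFloor_imp : ¬C → X ∧ ¬RH` (irrefutable short of `¬RH` AND a construction of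
  one-signed full bottom states on unbounded windows); `groundBartaFloor_iff_of_not_rh` (under `¬RH`
  the crux says exactly "good windows are bounded"); `closes'` — the route closes WITHOUT the support
  item `OddNegativityOffLine` (Weil's criterion replaces the odd detector).
* Mutations: `groundBartaFloor_iff_zero_floor` (the `∃ e → 0` dressing carries no content);
  `groundBartaFloor_without_tendsto` (dropping `Tendsto e` makes it a theorem);
  `groundBartaFloorWithoutGoodWindow_iff_rh` (dropping the hypothesis gives RH itself);
  `groundBartaFloorWithoutSign_iff_rh` (dropping ONLY the sign clause gives RH itself, modulo the
  existence of bottom states = CCM 2025 Thm 3.6 / Bombieri 2000 Thm 3, a named claim in the tree):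
  the sign clause is the load-bearing hypothesis.
* `not_goodWindow_of_nonpos` — degenerate windows `a ≤ 0` carry no bottom state (harmless under `a ≥ a₀`).
-/

noncomputable section
set_option linter.dupNamespace false

namespace Summit.RiemannHypothesis.RiemannHypothesis.Cruxes.GroundBartaFloor.Attack

open Filter Set MeasureTheory
open scoped Topology
open Literature.NumberTheory.LFunctions
open Summit.RiemannHypothesis.RiemannHypothesis.Theses.GroundBarta

/-! ## Vocabulary -/

/-- The junk-free ("`∀ h ∀ δ ∀ᶠ n`") ground-state predicate inlined by the route items: `u ∈ L²` is
the `L²`-limit of an `L²`-normalised sequence of window tests eventually below every normalised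
window test up to any `δ > 0`. -/
def IsGroundStateJF (a : ℝ) (u : ℝ → ℂ) : Prop :=
  MemLp u 2 ∧ ∃ g : ℕ → ℝ → ℂ,
    (∀ n, IsWeilTest (g n) ∧ tsupport (g n) ⊆ Icc (-a) a ∧ ∫ t, ‖g n t‖ ^ 2 = (1 : ℝ)) ∧
    (∀ h : ℝ → ℂ, IsWeilTest h → tsupport h ⊆ Icc (-a) a → ∫ t, ‖h t‖ ^ 2 = (1 : ℝ) →
      ∀ δ : ℝ, 0 < δ → ∀ᶠ n in atTop, (weilQuadratic (g n)).re ≤ (weilQuadratic h).re + δ) ∧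
    Tendsto (fun n => ∫ t, ‖g n t - u t‖ ^ 2) atTop (nhds 0)

/-- A window `a` is GOOD when it carries a bottom state of the FULL form that is real and `≥ 0`
a.e. on the open window (the hypothesis clause of the crux). -/
def GoodWindow (a : ℝ) : Prop :=
  ∃ u : ℝ → ℂ, IsGroundStateJF a u ∧ (∀ᵐ t : ℝ, t ∈ Ioo (-a) a → (u t).im = 0 ∧ 0 ≤ (u t).re)

/-- The planner's redirected (unfiled) thesis `X = PositiveGroundWindows`: good windows beyond
every height. -/
def PositiveGroundWindows : Prop :=
  ∀ A : ℝ, ∃ a : ℝ, A ≤ a ∧ GoodWindow a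

/-- Weil positivity at every window, in the normalised form used by the crux. -/
def WindowPositivity : Prop :=
  ∀ a : ℝ, ∀ h : ℝ → ℂ, IsWeilTest h → tsupport h ⊆ Icc (-a) a →
    ∫ t, ‖h t‖ ^ 2 = (1 : ℝ) → 0 ≤ (weilQuadratic h).re

/-- The crux over the Literature vocabulary (definitional). -/
theorem groundBartaFloor_iff :
    GroundBartaFloor ↔
      ∃ e : ℝ → ℝ, Tendsto e atTop (nhds 0) ∧ ∃ a₀ : ℝ, ∀ a : ℝ, a₀ ≤ a → GoodWindow a →
        ∀ h : ℝ → ℂ, IsWeilTest h → tsupport h ⊆ Icc (-a) a →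
          ∫ t, ‖h t‖ ^ 2 = (1 : ℝ) → -e a ≤ (weilQuadratic h).re :=
  Iff.rfl

/-- The sibling crux #3 over the same vocabulary (definitional): beyond every height some window at
which "the even sector carries the bottom" implies a good window. -/
theorem polarPerronFrobenius_iff :
    PolarPerronFrobenius ↔
      ∀ A : ℝ, ∃ a : ℝ, A ≤ a ∧
        ((∀ o : ℝ → ℂ, IsWeilTest o → tsupport o ⊆ Icc (-a) a → (∀ t, o (-t) = -o t) →
            ∫ t, ‖o t‖ ^ 2 = (1 : ℝ) → ∀ δ : ℝ, 0 < δ → ∃ w : ℝ → ℂ, IsWeilTest w ∧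
              tsupport w ⊆ Icc (-a) a ∧ (∀ t, w (-t) = w t) ∧ ∫ t, ‖w t‖ ^ 2 = (1 : ℝ) ∧
              (weilQuadratic w).re ≤ (weilQuadratic o).re + δ) → GoodWindow a) :=
  Iff.rfl

/-! ## The junk-free encoding is Literature's `IsWeilGroundState` -/

/-- `ε(a) ≤ Re Q(h)` for every normalised window test `h`. -/
theorem weilGroundEnergy_le_of_sphere {a : ℝ} {h : ℝ → ℂ} (hh : IsWeilTest h)
    (hsupp : tsupport h ⊆ Icc (-a) a) (hnorm : ∫ t, ‖h t‖ ^ 2 = (1 : ℝ)) :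
    weilGroundEnergy a ≤ (weilQuadratic h).re :=
  csInf_le (bddBelow_weilQuadratic_sphere_holds a) ⟨h, hh, hsupp, hnorm, rfl⟩

/-- The two forms of "minimising" agree on the (bounded-below) sphere of the window. -/
theorem forall_eventually_le_iff_tendsto_weilGroundEnergy {a : ℝ} {g : ℕ → ℝ → ℂ}
    (hg : ∀ n, IsWeilTest (g n) ∧ tsupport (g n) ⊆ Icc (-a) a ∧ ∫ t, ‖g n t‖ ^ 2 = (1 : ℝ)) :
    (∀ h : ℝ → ℂ, IsWeilTest h → tsupport h ⊆ Icc (-a) a → ∫ t, ‖h t‖ ^ 2 = (1 : ℝ) →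
        ∀ δ : ℝ, 0 < δ → ∀ᶠ n in atTop, (weilQuadratic (g n)).re ≤ (weilQuadratic h).re + δ) ↔
      Tendsto (fun n ↦ (weilQuadratic (g n)).re) atTop (𝓝 (weilGroundEnergy a)) := by
  set S : Set ℝ := {x : ℝ | ∃ g : ℝ → ℂ, IsWeilTest g ∧ tsupport g ⊆ Icc (-a) a ∧
    ∫ t : ℝ, ‖g t‖ ^ 2 = 1 ∧ x = (weilQuadratic g).re} with hSdef
  have hS : BddBelow S := bddBelow_weilQuadratic_sphere_holds a
  have hε : weilGroundEnergy a = sInf S := rfl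
  have hmem : ∀ n, (weilQuadratic (g n)).re ∈ S := fun n ↦
    ⟨g n, (hg n).1, (hg n).2.1, (hg n).2.2, rfl⟩
  have hne : S.Nonempty := ⟨_, hmem 0⟩
  have hlow : ∀ n, weilGroundEnergy a ≤ (weilQuadratic (g n)).re := fun n ↦
    hε ▸ csInf_le hS (hmem n)
  constructor
  · intro H
    rw [tendsto_order]
    refine ⟨fun x hx ↦ Eventually.of_forall fun n ↦ hx.trans_le (hlow n), fun x hx ↦ ?_⟩
    have hδ : 0 < (x - weilGroundEnergy a) / 2 := by linarith
    have hlt : sInf S < weilGroundEnergy a + (x - weilGroundEnergy a) / 2 := by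
      rw [← hε]; linarith
    obtain ⟨y, ⟨h, hh, hsupp, hnorm, rfl⟩, hy⟩ := exists_lt_of_csInf_lt hne hlt
    filter_upwards [H h hh hsupp hnorm _ hδ] with n hn
    linarith
  · intro H h hh hsupp hnorm δ hδ
    have hle : weilGroundEnergy a ≤ (weilQuadratic h).re := weilGroundEnergy_le_of_sphere hh hsupp hnorm
    have hev : ∀ᶠ n in atTop, (weilQuadratic (g n)).re < weilGroundEnergy a + δ :=
      (tendsto_order.1 H).2 _ (by linarith)
    filter_upwards [hev] with n hn
    linarith

/-- **The inlined ground-state clause IS `IsWeilGroundState`.** -/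
theorem isGroundStateJF_iff (a : ℝ) (u : ℝ → ℂ) : IsGroundStateJF a u ↔ IsWeilGroundState a u :=
  and_congr_right fun _ ↦ exists_congr fun _ ↦ and_congr_right fun hg ↦
    and_congr_left fun _ ↦ forall_eventually_le_iff_tendsto_weilGroundEnergy hg

/-- `GoodWindow` over the Literature vocabulary. -/
theorem goodWindow_iff (a : ℝ) :
    GoodWindow a ↔ ∃ u : ℝ → ℂ, IsWeilGroundState a u ∧
      (∀ᵐ t : ℝ, t ∈ Ioo (-a) a → (u t).im = 0 ∧ 0 ≤ (u t).re) :=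
  exists_congr fun u ↦ and_congr_left fun _ ↦ isGroundStateJF_iff a u

/-- Degenerate windows `a ≤ 0` are never good (no normalised window test exists). -/
theorem not_goodWindow_of_nonpos {a : ℝ} (ha : a ≤ 0) : ¬ GoodWindow a := by
  rintro ⟨u, hu, -⟩
  have hpos := IsWeilGroundState.pos ((isGroundStateJF_iff a u).1 hu)
  linarith

/-! ## Window positivity is RH (Weil's criterion, both halves in the tree) -/

/-- Normalised window positivity at every window is `WeilPositivityOn a` for every `a > 0`. -/
theorem windowPositivity_iff_forall : WindowPositivity ↔ ∀ a : ℝ, 0 < a → WeilPositivityOn a := by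
  constructor
  · intro h a ha
    refine (weilGroundEnergy_nonneg_iff_holds ha).1 (Real.sInf_nonneg ?_)
    rintro x ⟨g, hg, hs, hnorm, rfl⟩
    exact h a g hg hs hnorm
  · intro h a g hg hs hnorm
    rcases le_or_gt a 0 with ha | ha
    · have h0 : g = 0 := hg.eq_zero_of_tsupport_subset hs ha
      subst h0
      simp at hnorm
    · exact h a ha g hg hs

/-- … hence is the Riemann hypothesis (`riemannHypothesis_iff_forall_weilPositivityOn`, i.e.
Yoshida's form of Weil's criterion with `weil_criterion_holds`). -/
theorem windowPositivity_iff_rh : WindowPositivity ↔ RiemannHypothesis :=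
  windowPositivity_iff_forall.trans riemannHypothesis_iff_forall_weilPositivityOn.symm

/-! ## The shape of the crux -/

/-- `¬X → C`: if good windows are bounded the crux holds VACUOUSLY. -/
theorem groundBartaFloor_of_not_positiveGroundWindows (hX : ¬ PositiveGroundWindows) :
    GroundBartaFloor := by
  rw [groundBartaFloor_iff]
  unfold PositiveGroundWindows at hX
  push Not at hX
  obtain ⟨A, hA⟩ := hX
  exact ⟨fun _ ↦ 0, tendsto_const_nhds, A, fun a ha hgood ↦ absurd hgood (hA a ha)⟩

/-- Window positivity gives the crux with the zero floor. -/
theorem groundBartaFloor_of_windowPositivity (hpos : WindowPositivity) : GroundBartaFloor := by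
  rw [groundBartaFloor_iff]
  refine ⟨fun _ ↦ 0, tendsto_const_nhds, 0, fun a _ _ h hh hs hnorm ↦ ?_⟩
  rw [neg_zero]
  exact hpos a h hh hs hnorm

/-- `S → C`: under RH the crux holds (with `e ≡ 0`). -/
theorem groundBartaFloor_of_riemannHypothesis (hRH : RiemannHypothesis) : GroundBartaFloor :=
  groundBartaFloor_of_windowPositivity (windowPositivity_iff_rh.2 hRH)

/-- `C ∧ X →` Weil positivity at EVERY window (monotonicity of the window class and `e → 0`
along the unbounded good set). -/
theorem windowPositivity_of_groundBartaFloor (hC : GroundBartaFloor) (hX : PositiveGroundWindows) :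
    WindowPositivity := by
  rw [groundBartaFloor_iff] at hC
  obtain ⟨e, he, a₀, hfloor⟩ := hC
  intro b h hh hs hnorm
  by_contra hneg
  push Not at hneg
  have hev : ∀ᶠ a in atTop, e a < -(weilQuadratic h).re :=
    he.eventually (Iio_mem_nhds (by linarith))
  obtain ⟨A₁, hA₁⟩ := Filter.eventually_atTop.1 hev
  obtain ⟨a, ha, hgood⟩ := hX (max (max b a₀) A₁)
  have hb : b ≤ a := le_trans (le_trans (le_max_left _ _) (le_max_left _ _)) ha
  have ha₀ : a₀ ≤ a := le_trans (le_trans (le_max_right _ _) (le_max_left _ _)) ha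
  have hA₁a : A₁ ≤ a := le_trans (le_max_right _ _) ha
  have hs' : tsupport h ⊆ Icc (-a) a := hs.trans (Icc_subset_Icc (neg_le_neg hb) hb)
  have h1 := hfloor a ha₀ hgood h hh hs' hnorm
  have h2 := hA₁ a hA₁a
  linarith

/-- **The crux is the implication `X → Weil positivity at every window`.** -/
theorem groundBartaFloor_iff_imp : GroundBartaFloor ↔ (PositiveGroundWindows → WindowPositivity) :=
  ⟨windowPositivity_of_groundBartaFloor, fun H ↦
    (Classical.em PositiveGroundWindows).elim (fun hX ↦ groundBartaFloor_of_windowPositivity (H hX))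
      groundBartaFloor_of_not_positiveGroundWindows⟩

/-- **`C ↔ (X → RH)`, unconditionally.** -/
theorem groundBartaFloor_iff_thesis_imp_rh :
    GroundBartaFloor ↔ (PositiveGroundWindows → RiemannHypothesis) := by
  rw [groundBartaFloor_iff_imp, windowPositivity_iff_rh]

/-- Consequently the crux is IRREFUTABLE short of `¬RH`: `¬C → X ∧ ¬RH`. -/
theorem not_groundBartaFloor_imp (hC : ¬ GroundBartaFloor) :
    PositiveGroundWindows ∧ ¬ RiemannHypothesis := by
  rw [groundBartaFloor_iff_thesis_imp_rh] at hC
  push Not at hC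
  exact hC

/-- Under `¬RH` the crux says exactly: one-signed full bottom states live on a bounded set of windows. -/
theorem groundBartaFloor_iff_of_not_rh (hRH : ¬ RiemannHypothesis) :
    GroundBartaFloor ↔ ¬ PositiveGroundWindows := by
  rw [groundBartaFloor_iff_thesis_imp_rh]
  exact ⟨fun H hX ↦ hRH (H hX), fun H hX ↦ absurd hX H⟩

/-- **The floor function is decoration**: the crux is equivalent to itself with `e ≡ 0`. -/
theorem groundBartaFloor_iff_zero_floor :
    GroundBartaFloor ↔
      ∃ a₀ : ℝ, ∀ a : ℝ, a₀ ≤ a → GoodWindow a →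
        ∀ h : ℝ → ℂ, IsWeilTest h → tsupport h ⊆ Icc (-a) a →
          ∫ t, ‖h t‖ ^ 2 = (1 : ℝ) → 0 ≤ (weilQuadratic h).re := by
  constructor
  · intro hC
    by_cases hX : PositiveGroundWindows
    · exact ⟨0, fun a _ _ h hh hs hnorm ↦
        windowPositivity_of_groundBartaFloor hC hX a h hh hs hnorm⟩
    · unfold PositiveGroundWindows at hX
      push Not at hX
      obtain ⟨A, hA⟩ := hX
      exact ⟨A, fun a ha hgood ↦ absurd hgood (hA a ha)⟩
  · rintro ⟨a₀, h0⟩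
    rw [groundBartaFloor_iff]
    refine ⟨fun _ ↦ 0, tendsto_const_nhds, a₀, fun a ha hgood h hh hs hnorm ↦ ?_⟩
    rw [neg_zero]
    exact h0 a ha hgood h hh hs hnorm

/-! ## The route through the crux -/

/-- The redirected thesis `X` is exactly what cruxes #3 + #4 deliver. -/
theorem positiveGroundWindows_of (hPF : PolarPerronFrobenius) (hEven : EvenWinsBeyondArch) :
    PositiveGroundWindows := by
  intro A
  obtain ⟨a, ha, hgood⟩ := hPF (max A 1)
  refine ⟨a, le_trans (le_max_left _ _) ha, ?_⟩
  have ha1 : (1 : ℝ) ≤ a := le_trans (le_max_right _ _) ha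
  have hlog : Real.log 2 / 2 < a := by
    have h2 : Real.log 2 < 0.6931471808 := Real.log_two_lt_d9
    linarith
  exact hgood (hEven a hlog)

/-- The route closes WITHOUT its support item `OddNegativityOffLine`: Weil's criterion (in the tree)
replaces the odd off-line detector. -/
theorem closes' (hFloor : GroundBartaFloor) (hPF : PolarPerronFrobenius) (hEven : EvenWinsBeyondArch) :
    _root_.Summit.RiemannHypothesis :=
  groundBartaFloor_iff_thesis_imp_rh.1 hFloor (positiveGroundWindows_of hPF hEven)

/-! ## Hypothesis mutation (load-bearing analysis) -/

/-- **Dropping `Tendsto e atTop (𝓝 0)` makes the crux a theorem** (`e a := -ε(a)`; the sphere is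
bounded below). -/
theorem groundBartaFloor_without_tendsto :
    ∃ e : ℝ → ℝ, ∃ a₀ : ℝ, ∀ a : ℝ, a₀ ≤ a → GoodWindow a →
      ∀ h : ℝ → ℂ, IsWeilTest h → tsupport h ⊆ Icc (-a) a →
        ∫ t, ‖h t‖ ^ 2 = (1 : ℝ) → -e a ≤ (weilQuadratic h).re :=
  ⟨fun a ↦ -weilGroundEnergy a, 0, fun a _ _ h hh hs hnorm ↦ by
    rw [neg_neg]; exact weilGroundEnergy_le_of_sphere hh hs hnorm⟩

/-- The crux with the good-window hypothesis DROPPED. -/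
def GroundBartaFloorWithoutGoodWindow : Prop :=
  ∃ e : ℝ → ℝ, Tendsto e atTop (nhds 0) ∧ ∃ a₀ : ℝ, ∀ a : ℝ, a₀ ≤ a →
    ∀ h : ℝ → ℂ, IsWeilTest h → tsupport h ⊆ Icc (-a) a →
      ∫ t, ‖h t‖ ^ 2 = (1 : ℝ) → -e a ≤ (weilQuadratic h).re

/-- **Dropping the hypothesis `GoodWindow a` turns the crux into RH itself.** -/
theorem groundBartaFloorWithoutGoodWindow_iff_rh :
    GroundBartaFloorWithoutGoodWindow ↔ RiemannHypothesis := by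
  constructor
  · rintro ⟨e, he, a₀, hfloor⟩
    refine windowPositivity_iff_rh.1 fun b h hh hs hnorm ↦ ?_
    by_contra hneg
    push Not at hneg
    have hev : ∀ᶠ a in atTop, e a < -(weilQuadratic h).re :=
      he.eventually (Iio_mem_nhds (by linarith))
    obtain ⟨A₁, hA₁⟩ := Filter.eventually_atTop.1 hev
    set a := max (max b a₀) A₁ with ha
    have hb : b ≤ a := le_trans (le_max_left _ _) (le_max_left _ _)
    have ha₀ : a₀ ≤ a := le_trans (le_max_right _ _) (le_max_left _ _)
    have hA₁a : A₁ ≤ a := le_max_right _ _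
    have hs' : tsupport h ⊆ Icc (-a) a := hs.trans (Icc_subset_Icc (neg_le_neg hb) hb)
    have h1 := hfloor a ha₀ h hh hs' hnorm
    have h2 := hA₁ a hA₁a
    linarith
  · intro hRH
    have hpos := windowPositivity_iff_rh.2 hRH
    exact ⟨fun _ ↦ 0, tendsto_const_nhds, 0, fun a _ h hh hs hnorm ↦ by
      rw [neg_zero]; exact hpos a h hh hs hnorm⟩

/-- The crux with ONLY the sign clause dropped (any bottom state, one-signed or not). -/
def GroundBartaFloorWithoutSign : Prop :=
  ∃ e : ℝ → ℝ, Tendsto e atTop (nhds 0) ∧ ∃ a₀ : ℝ, ∀ a : ℝ, a₀ ≤ a →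
    (∃ u : ℝ → ℂ, IsGroundStateJF a u) →
    ∀ h : ℝ → ℂ, IsWeilTest h → tsupport h ⊆ Icc (-a) a →
      ∫ t, ‖h t‖ ^ 2 = (1 : ℝ) → -e a ≤ (weilQuadratic h).re

/-- **Dropping only the sign clause gives RH itself**, modulo the existence of bottom states at every
window (`ConnesConsaniMoscovici2025_thm_3_6`, CCM 2025 Thm 3.6 / Bombieri 2000 Thm 3 — a named claim
in the tree, used only in the direction `→`). So the SIGN of the bottom state is the load-bearing
hypothesis of the crux. -/
theorem groundBartaFloorWithoutSign_iff_rh (h36 : ConnesConsaniMoscovici2025_thm_3_6) :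
    GroundBartaFloorWithoutSign ↔ RiemannHypothesis := by
  constructor
  · rintro ⟨e, he, a₀, hfloor⟩
    refine windowPositivity_iff_rh.1 fun b h hh hs hnorm ↦ ?_
    by_contra hneg
    push Not at hneg
    have hev : ∀ᶠ a in atTop, e a < -(weilQuadratic h).re :=
      he.eventually (Iio_mem_nhds (by linarith))
    obtain ⟨A₁, hA₁⟩ := Filter.eventually_atTop.1 hev
    set a := max (max (max b a₀) A₁) 1 with ha
    have hb : b ≤ a := le_trans (le_trans (le_max_left _ _) (le_max_left _ _)) (le_max_left _ _)
    have ha₀ : a₀ ≤ a := le_trans (le_trans (le_max_right _ _) (le_max_left _ _)) (le_max_left _ _)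
    have hA₁a : A₁ ≤ a := le_trans (le_max_right _ _) (le_max_left _ _)
    have hapos : 0 < a := lt_of_lt_of_le one_pos (le_max_right _ _)
    have hs' : tsupport h ⊆ Icc (-a) a := hs.trans (Icc_subset_Icc (neg_le_neg hb) hb)
    obtain ⟨u, hu⟩ := h36.exists_isWeilGroundState hapos
    have h1 := hfloor a ha₀ ⟨u, (isGroundStateJF_iff a u).2 hu⟩ h hh hs' hnorm
    have h2 := hA₁ a hA₁a
    linarith
  · intro hRH
    have hpos := windowPositivity_iff_rh.2 hRH
    exact ⟨fun _ ↦ 0, tendsto_const_nhds, 0, fun a _ _ h hh hs hnorm ↦ by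
      rw [neg_zero]; exact hpos a h hh hs hnorm⟩

/-- For the record: `S → C` needs no good window, and `C` alone does not give `S`
(`groundBartaFloor_of_not_positiveGroundWindows`): the crux is the weakest rung `X → S` over the
thesis `X`, exactly as the odd twin `OddBartaFloor ↔ (OddOneSignedWindows → RH)`. -/
theorem windowPositivity_iff_rh' : WindowPositivity ↔ _root_.Summit.RiemannHypothesis :=
  windowPositivity_iff_rh

end Summit.RiemannHypothesis.RiemannHypothesis.Cruxes.GroundBartaFloor.Attack

end
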